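import Summits.PneNP.PneNP.Theorems.PhaseTwinsNoFBPPApproxAboveUniquenessConjectureWeb
import Summits.PneNP.PneNP.Theorems.PhaseTwinsNoFBPPApproxAboveUniquenessCalibrationWeb
import Summits.PneNP.PneNP.Theorems.PhaseTwinsNoFBPPApproxAboveUniquenessLever
import Literature.Computability.Complexity.ClayProblemProofs
import Literature.Computability.Complexity.SipserGacsLautemann
import Literature.Computability.Complexity.BFNWCase1
import Literature.Computability.Complexity.ExpTimeCollapsesProofs
import Literature.Computability.Complexity.EquivalenceProblemsCollapseProofs
import Literature.Computability.Complexity.UniformDerandomizationEndgame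
import Literature.Computability.Complexity.PolyHierarchy
import Literature.Computability.Complexity.NPClosureProofs
import Literature.Computability.Complexity.IKWScales
import Literature.Computability.Complexity.EasyWitness
import Literature.Computability.Complexity.NSubexp
import Literature.Computability.Complexity.TimeHierarchyProofs
import Literature.Computability.Complexity.TimeHierarchyDiagonal
import Literature.Computability.Complexity.ResourceBoundedMeasureFacts
import Literature.Computability.Complexity.SpaceProofs
import Literature.Computability.Complexity.CountingProofs
import Literature.Computability.Complexity.ProbabilisticClassesProofs

/-!
# DECOMPOSITION AUDIT — kernel-checked companion of STRATEGY-CENSUS.md §Decomposition (v4)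

Crux `stmt-PneNP-2717` = `X := Summit.PneNP.PneNP.Theses.PhaseTwins.NoFBPPApproxAboveUniqueness`,
route PhaseTwins; `S := _root_.PneNP` (the summit). EXEMPT-46 re-exam (verdict PIECE-EQUIVALENT)
asks for a typed decomposition `X₁ ∧ … ∧ X_k → X` with (a) every piece load-bearing, (b) a proved,
NON-TRIVIAL assembly, (c) no piece equivalent to / at least as strong as `X` or `S` — or a census of
every attempt with the violated clause. This file holds the parts of that census a kernel can check
(crux-strategist `cstrat-stmt-PneNP-2717-r1`, gen 1, 2026-08-17). 0 sorries. Nothing here is a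
landing; it is EVIDENCE. Every fact used is a PROVED theorem of the tree (no named-fact hypotheses).

## §1 Three audit lemmas (pure logic) that make (c)-violations and empty pieces mechanical
* `useless_piece`  — a piece implied by `¬S` never carries `S`: `(¬S → A) → (A → B → S) → (B → S)`.
* `conditional_piece` — a piece `A → X` whose antecedent follows from `¬S` is itself `≥ S`.
* `bridge_piece` — a piece with a PROVED arrow to `X` is `≥ S`.
With `X → S` proved (`pneNP_of_noFBPPApproxAboveUniqueness`), these sort every candidate piece into
(i) `⇒ S` known — violates (c); (ii) `⇐ ¬S` known — contributes nothing to `S` (drop it and the rest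
must still prove `S`); (iii) open under `¬S` — the only possible carriers of `S` jointly.

## §2 Type-(ii) certificates: the hardness-vs-randomness ingredients all follow from `P = NP`
`¬S → NP ⊆ P`, `NP ⊆ P → PH ⊆ P` (induction on the tree's `sigmaP`), `¬S → BPP = P`
(Sipser–Gács–Lautemann), `P ≠ EXP` (the tree's time hierarchy theorem at `2ⁿ` vs `2^{n²}`),
`¬S → EXP ≠ BPP`, `¬S → EXP ⊄ P/poly` (Meyer/Karp–Lipton), `¬S → (NP ⊆ BPP → NP ⊆ P)`, and
`P ⊆ io-DTIME(2^{⌈n^ε⌉})` for every `ε > 0`.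

## §3 The attempts, typed, each with its assembly and the clause it violates
D1 `S ∧ Derand` (piece = S), D2 `EXP ≠ BPP ∧ NP ⊄ io-SUBEXP_ε` (piece B ⇒ S in two lines; piece A
type (ii)), D6 three-piece dodge `EXP ≠ BPP ∧ P^{#P} ⊄ io-SUBEXP_ε ∧ (NP ⊆ BPP → P^{#P} ⊆ BPP)`
(assembly genuine, but `B ∧ C → S` is a 3-line seam bypassing it and `C ↔ X ∨ P^{#P} ⊆ BPP`),
D7 orthogonal conditional bridge `P ≠ PSPACE ∧ (P ≠ PSPACE → X)` (modus ponens; the other branch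
`P = PSPACE → X` IS `P ≠ PSPACE`), D8 win–win along `EXP ⊆ P/poly` (branch `EXP ⊄ P/poly → X` is
`≥ S`; branch `EXP ⊆ P/poly → X` is type (ii)), D9 bridges from above (`NP ⊄ P/poly`, OWF, PRG,
and "some `#P` function has no FPRAS" — each `≥ X`, the last covering EVERY statement in the route's
own statistical-physics vocabulary), §4 the `X ∨ E` normal form of pieces below `X`.
-/

set_option linter.dupNamespace false
set_option linter.unusedVariables false

namespace Summit.PneNP.PneNP.Cruxes.NoFBPPApproxAboveUniqueness.DecompositionAudit

open Filter Topology
open Literature.Computability.Complexity Literature.Probability.LatticeModels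
open Summit.PneNP.PneNP.Theses.PhaseTwins (NoFBPPApproxAboveUniqueness)
open Summit.PneNP.PneNP.Theorems
open Summit.PneNP.PneNP.Theorems.NoFBPPApproxAboveUniqueness
open _root_.Computability Literature.Computability.MetaComplexity

/-! ## §0 Recap: `X → S` (proved) and the summit in the prelude's classes -/

/-- `X ⟹ S`, unconditional in the tree (the route's `closes` fed by the proved `hN`, `hA`). [folklore] -/
theorem X_implies_S : NoFBPPApproxAboveUniqueness → _root_.PneNP :=
  pneNP_of_noFBPPApproxAboveUniqueness

/-- `S ↔ NP ⊄ P` (model bridges `P_bool_eq_holds`, `NP_bool_eq_holds`, both proved). [folklore] -/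
theorem pneNP_iff_not_NP_subset_P : _root_.PneNP ↔ ¬ (Nondeterministic.NP ⊆ Classes.P) := by
  have hP : PNPWave0.P Bool = Classes.P := P_bool_eq_holds
  have hNP : PNPWave0.NP Bool = Nondeterministic.NP := NP_bool_eq_holds
  show Literature.PNP.PNeNP ↔ _
  unfold Literature.PNP.PNeNP
  rw [hP, hNP, Set.not_subset]

/-! ## §1 The audit lemmas -/

/-- **USELESS-PIECE LEMMA.** If a piece `A` is a consequence of `¬S`, then from any assembly
`A → B → S` the remaining pieces `B` already prove `S`: a piece implied by `P = NP` carries none of the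
`P ≠ NP` content of a decomposition. [folklore] -/
theorem useless_piece {S A B : Prop} (hA : ¬ S → A) (h : A → B → S) : B → S :=
  fun hB => Classical.byContradiction fun hS => hS (h (hA hS) hB)

/-- **CONDITIONAL-PIECE LEMMA.** With `X → S` proved, a piece of the shape `A → X` whose antecedent
`A` is a consequence of `¬S` is itself at least as strong as `S`. (Kills every win–win split of `X`
along a dichotomy one side of which holds under `P = NP`.) [folklore] -/
theorem conditional_piece {S X A : Prop} (hXS : X → S) (hA : ¬ S → A) : (A → X) → S :=
  fun h => Classical.byContradiction fun hS => hS (hXS (h (hA hS)))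

/-- **BRIDGE LEMMA.** A piece `H` with a PROVED arrow `H → X` is at least `S`. [folklore] -/
theorem bridge_piece {S X H : Prop} (hXS : X → S) (hb : H → X) : H → S :=
  fun h => hXS (hb h)

/-- **Pieces below `X` are `X ∨ E`**, and two of them recombine to `X` iff their `E`-parts are
jointly inconsistent with `¬X`; the seam is then exactly as deep as that inconsistency proof.
[folklore] -/
theorem below_X_normal_form {X A : Prop} (h : X → A) : A ↔ (X ∨ (¬ X ∧ A)) := by
  tauto

theorem recombine_iff {X E₁ E₂ : Prop} : ((X ∨ E₁) → (X ∨ E₂) → X) ↔ (¬ X → ¬ (E₁ ∧ E₂)) := by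
  tauto

/-! ## §2 Type-(ii) certificates: consequences of `P = NP` in the tree's classes -/

/-- `¬S ⟹ NP ⊆ P`. [folklore] -/
theorem NP_subset_P_of_not_pneNP (h : ¬ _root_.PneNP) : Nondeterministic.NP ⊆ Classes.P := by
  by_contra h'
  exact h (pneNP_iff_not_NP_subset_P.2 h')

/-- `NP ⊆ P ⟹ Σₖᵖ ⊆ P` for every `k` (induction: `Σₖ₊₁ = ∃·coΣₖ ⊆ ∃·coP = Σ₁ = NP ⊆ P`).
[cite: AroraBarakCC2009, Thm. 5.4] -/
theorem SigmaP_subset_P_of_NP_subset_P (h : Nondeterministic.NP ⊆ Classes.P) :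
    ∀ k : ℕ, SigmaP k ⊆ Classes.P
  | 0 => SigmaP_zero.subset
  | k + 1 => by
    have ih : SigmaP k ⊆ Classes.P := SigmaP_subset_P_of_NP_subset_P h k
    have e : SigmaP (0 + 1) = Nondeterministic.NP := SigmaP_one_holds
    have h1 : SigmaP (k + 1) ⊆ SigmaP (0 + 1) := by
      rw [SigmaP_succ, SigmaP_succ, PiP_eq_co, PiP_eq_co]
      exact polyExists_mono (co_mono (ih.trans SigmaP_zero.symm.subset))
    rw [e] at h1
    exact h1.trans h

/-- **`NP ⊆ P ⟹ PH ⊆ P`** (the collapse of the hierarchy to `P`). [cite: AroraBarakCC2009, Thm. 5.4] -/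
theorem PH_subset_P_of_NP_subset_P (h : Nondeterministic.NP ⊆ Classes.P) : PH ⊆ Classes.P :=
  fun L hL => by
    obtain ⟨k, hk⟩ := Set.mem_iUnion.1 hL
    exact SigmaP_subset_P_of_NP_subset_P h k hk

/-- **`¬S ⟹ BPP = P`** (`BPP ⊆ Σ₂ᵖ ⊆ PH ⊆ P`, Sipser–Gács–Lautemann proved in the tree).
[cite: AroraBarakCC2009, Thm. 7.15] -/
theorem BPP_eq_P_of_not_pneNP (h : ¬ _root_.PneNP) : BPP = Classes.P :=
  ((BPP_subset_SigmaP_two.trans (SigmaP_subset_PH 2)).trans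
    (PH_subset_P_of_NP_subset_P (NP_subset_P_of_not_pneNP h))).antisymm P_subset_BPP_holds

/-- Growth condition for the hierarchy theorem at `T = 2ⁿ`, `U = 2^{n²}`: `(2ⁿ)² / 2^{n²} → 0`.
[folklore] -/
theorem tendsto_two_pow_sq_div_two_pow_sq :
    Tendsto (fun n : ℕ => (((2 ^ n : ℕ) : ℝ)) ^ 2 / ((2 ^ (n ^ 2) : ℕ) : ℝ)) atTop (𝓝 0) := by
  have hlim : Tendsto (fun n : ℕ => ((1 : ℝ) / 2) ^ n) atTop (𝓝 0) :=
    tendsto_pow_atTop_nhds_zero_of_lt_one (by norm_num) (by norm_num)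
  refine tendsto_of_tendsto_of_tendsto_of_le_of_le' tendsto_const_nhds hlim ?_ ?_
  · exact Eventually.of_forall fun n => by positivity
  · refine (eventually_ge_atTop 3).mono fun n hn => ?_
    have h2 : (0 : ℝ) < (2 : ℝ) ^ (n ^ 2) := by positivity
    push_cast
    rw [div_le_iff₀ h2, ← pow_mul]
    have hnn : n * 2 + n ≤ n ^ 2 := by nlinarith
    obtain ⟨d, hd⟩ := Nat.exists_eq_add_of_le hnn
    rw [hd, pow_add, pow_add]
    have h1 : ((1 : ℝ) / 2) ^ n * 2 ^ n = 1 := by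
      rw [← mul_pow]; norm_num
    have hd1 : (1 : ℝ) ≤ 2 ^ d := one_le_pow₀ (by norm_num)
    calc (2 : ℝ) ^ (n * 2) = (2 : ℝ) ^ (n * 2) * (((1 : ℝ) / 2) ^ n * 2 ^ n) * 1 := by rw [h1]; ring
      _ ≤ (2 : ℝ) ^ (n * 2) * (((1 : ℝ) / 2) ^ n * 2 ^ n) * 2 ^ d := by gcongr
      _ = ((1 : ℝ) / 2) ^ n * (2 ^ (n * 2) * 2 ^ n * 2 ^ d) := by ring

/-- **`P ≠ EXP`** from the tree's PROVED time hierarchy theorem (`time_hierarchy_holds`) at the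
time-constructible bounds `2ⁿ`, `2^{n²}`: a language in `DTIME(2^{n²}) \ DTIME(2ⁿ)` lies in `EXP` and,
as `P ⊆ DTIME(2ⁿ)`, outside `P`. [cite: AroraBarakCC2009, Thm. 3.1] -/
theorem P_ne_EXP : Classes.P ≠ EXP := by
  intro hPE
  have hth : DTIME (fun n => 2 ^ n) ⊂ DTIME (fun n => 2 ^ (n ^ 2)) :=
    time_hierarchy_holds (fun n => 2 ^ n) (fun n => 2 ^ (n ^ 2)) TimeConstructible.isTimeConstructible_two_pow
      TimeConstructible.isTimeConstructible_two_pow_sq tendsto_two_pow_sq_div_two_pow_sq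
  obtain ⟨L, hLU, hLT⟩ := Set.exists_of_ssubset hth
  have hLEXP : L ∈ EXP := Set.mem_iUnion.2 ⟨2, hLU⟩
  rw [← hPE] at hLEXP
  have hP2 : Classes.P ⊆ DTIME (fun n => 2 ^ n) :=
    P_subset_DTIME_two_pow.trans (DTIME_mono fun n => le_of_eq (by rw [Nat.one_mul]))
  exact hLT (hP2 hLEXP)

/-- **`¬S ⟹ EXP ≠ BPP`** — so `EXP ≠ BPP` is a consequence of `P = NP` (type (ii)): by
`useless_piece` it never carries `S`-content. [folklore] -/
theorem EXP_ne_BPP_of_not_pneNP (h : ¬ _root_.PneNP) : EXP ≠ BPP :=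
  fun hEB => P_ne_EXP (hEB.trans (BPP_eq_P_of_not_pneNP h)).symm

/-- **`¬S ⟹ EXP ⊄ P/poly`** (Meyer: `EXP ⊆ P/poly → EXP = Σ₂ᵖ`, proved in the tree; under `P = NP`
that is `EXP = P`, against the hierarchy). Type (ii) again. [cite: AroraBarakCC2009, Thm. 6.20] -/
theorem not_EXP_subset_PPoly_of_not_pneNP (h : ¬ _root_.PneNP) : ¬ EXP ⊆ PPoly := fun hsub =>
  P_ne_EXP (Set.Subset.antisymm P_subset_EXP (by
    rw [EXP_eq_SigmaP_two_of_subset_PPoly_holds hsub]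
    exact (SigmaP_subset_PH 2).trans (PH_subset_P_of_NP_subset_P (NP_subset_P_of_not_pneNP h))))

/-- **`P ⊆ DTIME(2^{⌈n^ε⌉})` for every `ε > 0`** (`nᵏ ≤ (k+1)(1+n)^{k+1} + (k+1) ≤ 2^{⌈n^ε⌉}`
eventually, the tree's `eventually_cost_pow_le_two_pow_ceil_rpow`). [folklore] -/
theorem P_subset_DTIME_two_pow_ceil_rpow {ε : ℝ} (hε : 0 < ε) :
    Classes.P ⊆ DTIME (fun n => 2 ^ ⌈(n : ℝ) ^ ε⌉₊) := by
  intro L hL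
  obtain ⟨k, hk⟩ := Set.mem_iUnion.1 hL
  have hε' : ((0 : ℕ) : ℝ) * (1 / 2 : ℝ) ^ (0 : ℕ) < ε := by simpa using hε
  have hev := eventually_cost_pow_le_two_pow_ceil_rpow (k + 1) 0 0 0 hε'
  obtain ⟨N, hN⟩ := Filter.eventually_atTop.1 hev
  refine DTIME_subset_DTIME_of_eventually_le (N := N) (fun n hn => ?_) hk
  have h1 := hN n hn
  simp only [zero_mul, pow_zero, Function.iterate_zero, id_eq] at h1
  calc n ^ k ≤ (1 + n) ^ k := Nat.pow_le_pow_left (Nat.le_add_left n 1) k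
    _ ≤ (1 + n) ^ (k + 1) := Nat.pow_le_pow_right (by omega) (Nat.le_succ k)
    _ ≤ (k + 1) * (1 + n) ^ (k + 1) + (k + 1) := by nlinarith [Nat.zero_le ((1 + n) ^ (k + 1))]
    _ ≤ 2 ^ ⌈(n : ℝ) ^ ε⌉₊ := h1

/-- **`P ⊆ io-DTIME(2^{⌈n^ε⌉})`** for every `ε > 0`. [folklore] -/
theorem P_subset_io_subexp {ε : ℝ} (hε : 0 < ε) :
    Classes.P ⊆ io (DTIME fun n => 2 ^ ⌈(n : ℝ) ^ ε⌉₊) :=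
  (P_subset_DTIME_two_pow_ceil_rpow hε).trans (subset_io _)

/-! ## §3 The attempts -/

/-! ### D1 — the exact split `X ↔ S ∧ (NP ⊆ BPP → NP ⊆ P)` (census v3, fact-free) -/

/-- Sub₂ of D1. -/
def DerandUnderCollapse : Prop :=
  Nondeterministic.NP ⊆ BPP → Nondeterministic.NP ⊆ Classes.P

/-- D1 assembly (2 lines: violates (b)); piece 1 IS `S` (violates (c): the probe `PneNP → PneNP`
closes by `id`). [folklore] -/
theorem D1_assembly (h₁ : _root_.PneNP) (h₂ : DerandUnderCollapse) : NoFBPPApproxAboveUniqueness :=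
  noFBPPApproxAboveUniqueness_of_not_NP_subset_BPP fun hNP =>
    (pneNP_iff_not_NP_subset_P.1 h₁) (h₂ hNP)

theorem D1_converse (hX : NoFBPPApproxAboveUniqueness) : _root_.PneNP ∧ DerandUnderCollapse :=
  ⟨X_implies_S hX, fun hNP => absurd hNP (noFBPPApproxAboveUniqueness_iff_not_NP_subset_BPP.1 hX)⟩

example : _root_.PneNP → _root_.PneNP := id

/-- Piece 2 of D1 is type (ii) (a consequence of `P = NP`): it carries no `S`-content. [folklore] -/
theorem D1_piece2_typeii (h : ¬ _root_.PneNP) : DerandUnderCollapse :=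
  fun _ => NP_subset_P_of_not_pneNP h

/-! ### D2 — the coin split of line `Sketch` (EXEMPT-46: PIECE-EQUIVALENT) -/

/-- Piece A of D2/D6/D8. -/
def D2A : Prop := EXP ≠ BPP

/-- Piece B of D2: an a.e. sub-exponential lower bound for `NP`. -/
def D2B : Prop :=
  ∃ ε : ℝ, 0 < ε ∧ ¬ Nondeterministic.NP ⊆ io (DTIME fun n => 2 ^ ⌈(n : ℝ) ^ ε⌉₊)

/-- D2 assembly (Zachos + Meyer + BFNW, all proved in the tree; ideator 2's `noFBPP_of_split`):
GENUINE — it passes (b). [cite: BabaiFortnowNisanWigderson1993, Thm 1.2] -/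
theorem D2_assembly (hA : D2A) (hB : D2B) : NoFBPPApproxAboveUniqueness :=
  noFBPPApproxAboveUniqueness_of_not_NP_subset_BPP fun hNP => by
    obtain ⟨ε, hε, hio⟩ := hB
    have hPH : PH ⊆ BPP := PH_subset_BPP_of_NP_subset_BPP hNP
    have hEXP : ¬ EXP ⊆ PPoly := fun hsub => hA (by
      apply Set.Subset.antisymm
      · rw [EXP_eq_SigmaP_two_of_subset_PPoly_holds hsub]
        exact (SigmaP_subset_PH 2).trans hPH
      · exact BPP_subset_EXP)
    exact hio (hNP.trans (BPP_subset_io_DTIME_of_not_EXP_subset_PPoly hEXP hε))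

/-- **(c) violated by piece B: `D2B → S` in two lines** (`P ⊆ io-DTIME(2^{⌈n^ε⌉})`). This is the
auditor's "stub_NP_not_ioSubexp alone ⇒ PneNP", now kernel-checked. [folklore] -/
theorem D2_pieceB_dominates (hB : D2B) : _root_.PneNP := by
  obtain ⟨ε, hε, hio⟩ := hB
  exact pneNP_iff_not_NP_subset_P.2 fun hNP => hio (hNP.trans (P_subset_io_subexp hε))

/-- Piece A is type (ii); by `useless_piece`, whatever replaces B must prove `S` on its own — which is
the auditor's second finding ("every stub set yielding X contains a conjecture-grade piece ≥ X")
for all splits of the shape `EXP ≠ BPP ∧ B`. [folklore] -/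
theorem D2_pieceA_typeii (h : ¬ _root_.PneNP) : D2A :=
  EXP_ne_BPP_of_not_pneNP h

theorem D2_any_partner_carries_S (B : Prop) (h : D2A → B → _root_.PneNP) : B → _root_.PneNP :=
  useless_piece D2_pieceA_typeii h

/-! ### D6 — the three-piece dodge: replace `NP ⊄ io-SUBEXP` by a COUNTING lower bound plus a
collapse-transfer conditional (designed so that no single piece implies `S`) -/

/-- Piece B of D6: an a.e. sub-exponential lower bound for `P^{#P}` — open under `P = NP` as well
(type (iii)); no known arrow to `S`. -/
def D6B : Prop :=
  ∃ ε : ℝ, 0 < ε ∧ ¬ PSharpP ⊆ io (DTIME fun n => 2 ^ ⌈(n : ℝ) ^ ε⌉₊)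

/-- Piece C of D6: "if `NP` is easy for randomised polynomial time then so is exact counting". -/
def D6C : Prop :=
  Nondeterministic.NP ⊆ BPP → PSharpP ⊆ BPP

/-- D6 assembly — genuine (the D2 engine with `P^{#P}` in place of `NP`); the mechanical probes
`A → S`, `B → S`, `C → S`, `· → X` all FAIL (no landed arrows; see `bc/probes.lean`). [folklore] -/
theorem D6_assembly (hA : D2A) (hB : D6B) (hC : D6C) : NoFBPPApproxAboveUniqueness :=
  noFBPPApproxAboveUniqueness_of_not_NP_subset_BPP fun hNP => by
    obtain ⟨ε, hε, hio⟩ := hB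
    have hPH : PH ⊆ BPP := PH_subset_BPP_of_NP_subset_BPP hNP
    have hEXP : ¬ EXP ⊆ PPoly := fun hsub => hA (by
      apply Set.Subset.antisymm
      · rw [EXP_eq_SigmaP_two_of_subset_PPoly_holds hsub]
        exact (SigmaP_subset_PH 2).trans hPH
      · exact BPP_subset_EXP)
    exact hio ((hC hNP).trans (BPP_subset_io_DTIME_of_not_EXP_subset_PPoly hEXP hε))

/-- **… but the `S`-content bypasses the engine: `B ∧ C → S` is a three-line seam** (under `P = NP`,
`C` gives `P^{#P} ⊆ BPP = P ⊆ io-SUBEXP`, against `B`). So the non-trivial assembly only serves the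
derandomisation conjunct of `X`; for `S` the split is D1's trivial seam in costume — violates (b) in
substance, and `A` is again an empty piece (`useless_piece`). [folklore] -/
theorem D6_seam (hB : D6B) (hC : D6C) : _root_.PneNP := by
  by_contra hS
  obtain ⟨ε, hε, hio⟩ := hB
  have hNP : Nondeterministic.NP ⊆ BPP := (NP_subset_P_of_not_pneNP hS).trans P_subset_BPP_holds
  exact hio (((hC hNP).trans (BPP_eq_P_of_not_pneNP hS).subset).trans (P_subset_io_subexp hε))

/-- **… and `C` is `X ∨ (P^{#P} ⊆ BPP)`**: a statement whose only support is `X` itself (its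
non-vacuous content lives in the `NP ⊆ BPP` world nobody believes in) — not a genuine piece. [folklore] -/
theorem D6C_iff : D6C ↔ (NoFBPPApproxAboveUniqueness ∨ PSharpP ⊆ BPP) := by
  rw [noFBPPApproxAboveUniqueness_iff_not_NP_subset_BPP]
  unfold D6C
  tauto

/-! ### D7 — conditional bridge from an ORTHOGONAL hypothesis (`P ≠ PSPACE`), equivalently the
win–win split of `X` along `P = PSPACE` -/

/-- Piece H of D7: type (iii), believed, no arrow to `S` known. -/
def D7H : Prop := Classes.P ≠ PSPACE

/-- Piece Br of D7: "`X`, granted `P ≠ PSPACE`". -/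
def D7Br : Prop := Classes.P ≠ PSPACE → NoFBPPApproxAboveUniqueness

/-- D7 assembly = modus ponens: violates (b). [folklore] -/
theorem D7_assembly (h : D7H) (b : D7Br) : NoFBPPApproxAboveUniqueness :=
  b h

/-- `P = PSPACE` refutes `X` (`NP ⊆ PSPACE = P ⊆ BPP`). [folklore] -/
theorem not_X_of_P_eq_PSPACE (h : Classes.P = PSPACE) : ¬ NoFBPPApproxAboveUniqueness := by
  rw [noFBPPApproxAboveUniqueness_iff_not_NP_subset_BPP, not_not]
  have hNP : Nondeterministic.NP ⊆ PSPACE := NP_subset_PSPACE_holds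
  exact (hNP.trans h.symm.subset).trans P_subset_BPP_holds

/-- **The other branch of the win–win IS the orthogonal separation**: `(P = PSPACE → X) ↔ P ≠ PSPACE`.
So splitting `X` along `P` vs `PSPACE` yields `{P ≠ PSPACE, P ≠ PSPACE → X}` and nothing else. [folklore] -/
theorem D7_branch_iff : (Classes.P = PSPACE → NoFBPPApproxAboveUniqueness) ↔ D7H :=
  ⟨fun h hEq => not_X_of_P_eq_PSPACE hEq (h hEq), fun h hEq => absurd hEq h⟩

/-- **… and Br is `X ∨ (P = PSPACE)`** — `X` with an inert hypothesis; no why-easier. [folklore] -/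
theorem D7Br_iff : D7Br ↔ (NoFBPPApproxAboveUniqueness ∨ Classes.P = PSPACE) := by
  unfold D7Br
  tauto

/-! ### D8 — win–win along `EXP ⊆ P/poly` (the Karp–Lipton/Meyer dichotomy powering BFNW and IW) -/

/-- Branch 1: under `EXP ⊆ P/poly`. -/
def D8W₁ : Prop := EXP ⊆ PPoly → NoFBPPApproxAboveUniqueness

/-- Branch 2: under `EXP ⊄ P/poly`. -/
def D8W₂ : Prop := ¬ EXP ⊆ PPoly → NoFBPPApproxAboveUniqueness

/-- D8 assembly = proof by cases (violates (b)). [folklore] -/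
theorem D8_assembly (h₁ : D8W₁) (h₂ : D8W₂) : NoFBPPApproxAboveUniqueness :=
  (Classical.em (EXP ⊆ PPoly)).elim (fun h => h₁ h) (fun h => h₂ h)

/-- **(c) violated: branch 2 is `≥ S`** (`conditional_piece` with `¬S → EXP ⊄ P/poly`). [folklore] -/
theorem D8W₂_dominates : D8W₂ → _root_.PneNP :=
  conditional_piece X_implies_S not_EXP_subset_PPoly_of_not_pneNP

/-- Branch 1 follows from `EXP ≠ BPP` (Meyer + Zachos) … [cite: AroraBarakCC2009, Thm. 6.20] -/
theorem D8W₁_of_EXP_ne_BPP (hA : D2A) : D8W₁ := fun hsub =>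
  noFBPPApproxAboveUniqueness_of_not_NP_subset_BPP fun hNP => hA (by
    apply Set.Subset.antisymm
    · rw [EXP_eq_SigmaP_two_of_subset_PPoly_holds hsub]
      exact (SigmaP_subset_PH 2).trans (PH_subset_BPP_of_NP_subset_BPP hNP)
    · exact BPP_subset_EXP)

/-- … hence branch 1 is type (ii): all of `S` sits in branch 2. [folklore] -/
theorem D8W₁_typeii (h : ¬ _root_.PneNP) : D8W₁ :=
  D8W₁_of_EXP_ne_BPP (D2_pieceA_typeii h)

/-! ### D9 — bridges from ABOVE `X` (each a single piece `≥ X`: violates (c) via `bridge_piece`) -/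

/-- **Every approximate-counting hardness statement is already `≥ X`**: if SOME `#P` function has no
FPRAS then `X` (the landed lever `NP ⊆ BPP → every #P function has an FPRAS` + calibration). This
covers every piece expressible in the route's own vocabulary — no-FPRAS for the hard-core model at any
`(Δ, λ)`, for `#BIS`, the antiferromagnetic Ising/Potts partition functions, … [folklore] -/
theorem D9_noFPRAS_piece (h : ∃ f ∈ SharpP, ¬ HasFPRAS f) : NoFBPPApproxAboveUniqueness :=
  noFBPPApproxAboveUniqueness_of_not_NP_subset_BPP fun hNP => by
    obtain ⟨f, hf, hno⟩ := h
    exact hno (hasFPRAS_of_sharpP_of_NP_subset_BPP hNP hf)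

/-- The landed bridges (the probes `exact?` FIND these, so each antecedent fails (c) mechanically):
`NP ⊄ P/poly → X` (Adleman), `OWFExist → X`, `PRGExist → X`. [cite: AroraBarakCC2009, Thm. 7.14] -/
theorem D9_landed_bridges :
    (Summit.PneNP.PneNP.NPNotSubsetPPoly → NoFBPPApproxAboveUniqueness) ∧
    (Literature.Computability.Cryptography.OWFExist → NoFBPPApproxAboveUniqueness) ∧
    (Literature.Computability.Cryptography.PRGExist → NoFBPPApproxAboveUniqueness) :=
  ⟨noFBPPApproxAboveUniqueness_of_NPNotSubsetPPoly, noFBPPApproxAboveUniqueness_of_OWFExist,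
    noFBPPApproxAboveUniqueness_of_PRGExist⟩

/-- … so each is `≥ S` as a piece. [folklore] -/
theorem D9_pieces_ge_S :
    (Summit.PneNP.PneNP.NPNotSubsetPPoly → _root_.PneNP) ∧
    (Literature.Computability.Cryptography.OWFExist → _root_.PneNP) ∧
    ((∃ f ∈ SharpP, ¬ HasFPRAS f) → _root_.PneNP) :=
  ⟨bridge_piece X_implies_S noFBPPApproxAboveUniqueness_of_NPNotSubsetPPoly,
    bridge_piece X_implies_S noFBPPApproxAboveUniqueness_of_OWFExist,
    bridge_piece X_implies_S D9_noFPRAS_piece⟩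

/-! ## §4 Summary theorem: where the `S`-content of ANY split of `X` can live -/

/-- **Any split of `X` is a split of `S`, and its type-(ii) pieces can be deleted**: if
`A₁ → A₂ → B → X` with `A₁`, `A₂` consequences of `¬S` (e.g. `EXP ≠ BPP`, `EXP ⊄ P/poly`, `BPP = P`,
`NP ⊆ BPP → NP ⊆ P`), then `B → S` outright. Instantiated above at D2 (`B := NP ⊄ io-SUBEXP_ε`),
D6 (`B := D6B ∧ D6C`, where the residual seam is three lines) and D8. [folklore] -/
theorem split_residue {A₁ A₂ B : Prop} (h₁ : ¬ _root_.PneNP → A₁) (h₂ : ¬ _root_.PneNP → A₂)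
    (h : A₁ → A₂ → B → NoFBPPApproxAboveUniqueness) : B → _root_.PneNP :=
  fun hB => Classical.byContradiction fun hS => hS (X_implies_S (h (h₁ hS) (h₂ hS) hB))

end Summit.PneNP.PneNP.Cruxes.NoFBPPApproxAboveUniqueness.DecompositionAudit
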